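import Summits.ValiantsHypothesis.ValiantsHypothesis.Theorems.GrenetZeonDualUnipotentThreeHalvesLongMassRankOneResolvent

/-!
# `GrenetZeon.DualUnipotentThreeHalves` (stmt-ValiantsHypothesis-24318), line `slow_core`, stub `stub_longMassSlowLawInv` ((c)):
# ★★★ (c) HOLDS (`c = 3`) FOR EVERY AFFINE NILPOTENT PENCIL WHOSE LINEAR COEFFICIENT MATRICES ALL HAVE RANK ≤ 1 — constant part ARBITRARY

The closing file of the rank-one row (✓ `…LongMassRankOne`, `…Acyclic`, `…Triangular`, `…Affine`, `…AcyclicDomain`, `…Resolvent`).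
THEOREM ★★★ `relCert_of_rankOne_linearPart`: an affine pencil `N : AffMat n m` with `N ^ H = 0` and EVERY coefficient matrix
`[x_e] N = u_e w_eᵀ` an outer product (rank `≤ 1`) — the constant part `A₀ = N(0)` being an ARBITRARY (necessarily nilpotent) matrix — satisfies
`RelCert n m N (3·(⌊√n⌋·m))`, the conclusion of (c) `LongMassSlowLawInv` / `LongMassSlowLawAll` with `c = 3`, `n₀ = 0`.  Read contrapositively for
the enemy spec (crit-7 V34 §2): **every (c)-violator family has a coefficient matrix of rank ≥ 2** (indeed, with ✓ `count_criterion_needs_rankTwo`,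
many of them under the census instrument).

Proof.  By ✓ `exists_levels_resolvent` (homogenised nilpotency `c•A₀ + Σ x_e V_e`, resolvent Gram matrix over `ℂ[s]`) the coordinates carry
levels `ℓ` with `w_e · A₀^a u_{e'} = 0` for all `a` whenever `ℓ e' ≤ ℓ e`.  §1: the flag `F_t := span{A₀^a u_e : ℓ e < t}` (`= ⊤` past the top
level) is `A₀`-STABLE and LOWERED by every `V_e = u_e w_eᵀ` (`V_{e'} A₀^a u_e = (w_{e'}·A₀^a u_e) u_{e'}`), so for the family `{A₀} ∪ {V_e}` every
`p(·)·[F_k, F_l]` lowers the flag (or is `0` for `[A₀, A₀]`) and is nilpotent; McCoy (✓ Literature `forall_isNilpotent_iff_exists_isUnit`) gives ONE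
invertible `S` triangularising `A₀` and all `V_e`.  §2: every value `S⁻¹ N(x) S = S⁻¹A₀S + Σ x_e S⁻¹V_eS` is upper triangular and nilpotent, hence
strictly upper triangular (✓ `diag_eq_zero_of_isNilpotent_triangular`), and ✓ `TriangularRow.relCert_of_values_triangularisable` prices the pencil.

Honest framing: a support row (`--supports stmt-ValiantsHypothesis-24318`): the locus (rank-one linear part) is reducible whenever non-trivial, so it
never contains an `IrreducibleInv` constituent of size `≥ 2`; NOT progress on (c) `SlowCore.LongMassSlowLawInv` itself, which with S3, 24318, 8062,
VP ≠ VNP stays OPEN / NOT proved.  No sorry, no definitions, no named facts. [folklore; McCoy via the tree]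
-/

-- single-conjunct layout: Sub = Summit, duplicated namespace component intended (the name is mandated)
set_option linter.dupNamespace false
set_option autoImplicit false

noncomputable section

namespace Summit.ValiantsHypothesis.ValiantsHypothesis.Theorems.GrenetZeon.LongMassRankOne

open MvPolynomial Matrix
open scoped BigOperators
open Summit.ValiantsHypothesis.ValiantsHypothesis.Cruxes.TwoDimCoefficients.DimTwoCases (AffMat IsAffine)
open Summit.ValiantsHypothesis.ValiantsHypothesis.Theorems.GrenetZeon.SlowCore (RelCert)
open Summit.ValiantsHypothesis.ValiantsHypothesis.Theorems.GrenetZeon.FlagCost (conj_pow_eq)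
open Summit.ValiantsHypothesis.ValiantsHypothesis.Theorems.GrenetZeon.TriangularRow (relCert_of_values_triangularisable)
open Summit.ValiantsHypothesis.ValiantsHypothesis.Theorems.GrenetZeon.HeavyTopCodimOnePattern (diag_eq_zero_of_isNilpotent_triangular)
open Summit.ValiantsHypothesis.ValiantsHypothesis.Theorems.GrenetZeon.RadicalSplit (linPart linPart_pow_eq_zero)

variable {m : ℕ}

/-! ## §1 The `A₀`-stable flag and McCoy's criterion for `{A₀} ∪ {u_e w_eᵀ}` -/

section FlagA

variable {κ : Type*}
variable (A₀ : Matrix (Fin m) (Fin m) ℂ) (u w : κ → Fin m → ℂ) (ℓ : κ → ℕ) (L : ℕ)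

/-- Monotonicity of the flag `F t = span{A₀^a u_e : ℓ e < t}` (`= ⊤` past `L`), membership form. -/
theorem mem_flagA_succ_of_mem (t : ℕ) {x : Fin m → ℂ}
    (hx : x ∈ Submodule.span ℂ {v : Fin m → ℂ | (∃ e a, ℓ e < t ∧ v = A₀ ^ a *ᵥ u e) ∨ L < t}) :
    x ∈ Submodule.span ℂ {v : Fin m → ℂ | (∃ e a, ℓ e < t + 1 ∧ v = A₀ ^ a *ᵥ u e) ∨ L < t + 1} := by
  refine Submodule.span_mono ?_ hx
  rintro v (⟨e, a, he, rfl⟩ | hL)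
  · exact Or.inl ⟨e, a, by omega, rfl⟩
  · exact Or.inr (by omega)

/-- The bottom of the flag is trivial. -/
theorem eq_zero_of_mem_flagA_zero {x : Fin m → ℂ}
    (hx : x ∈ Submodule.span ℂ {v : Fin m → ℂ | (∃ e a, ℓ e < 0 ∧ v = A₀ ^ a *ᵥ u e) ∨ L < 0}) : x = 0 := by
  have h : Submodule.span ℂ {v : Fin m → ℂ | (∃ e a, ℓ e < 0 ∧ v = A₀ ^ a *ᵥ u e) ∨ L < 0} = ⊥ := by
    rw [Submodule.span_eq_bot]
    rintro v (⟨e, a, he, -⟩ | hL)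
    · exact absurd he (Nat.not_lt_zero _)
    · exact absurd hL (Nat.not_lt_zero _)
  rw [h] at hx
  exact (Submodule.mem_bot ℂ).mp hx

/-- Everything lies in the top of the flag. -/
theorem mem_flagA_top (x : Fin m → ℂ) :
    x ∈ Submodule.span ℂ {v : Fin m → ℂ | (∃ e a, ℓ e < L + 1 ∧ v = A₀ ^ a *ᵥ u e) ∨ L < L + 1} :=
  Submodule.subset_span (Or.inr (Nat.lt_succ_self L))

/-- `A₀` PRESERVES each `F t`. -/
theorem constPart_mulVec_mem_flagA (t : ℕ) (x : Fin m → ℂ)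
    (hx : x ∈ Submodule.span ℂ {v : Fin m → ℂ | (∃ e a, ℓ e < t ∧ v = A₀ ^ a *ᵥ u e) ∨ L < t}) :
    A₀ *ᵥ x ∈ Submodule.span ℂ {v : Fin m → ℂ | (∃ e a, ℓ e < t ∧ v = A₀ ^ a *ᵥ u e) ∨ L < t} := by
  induction hx using Submodule.span_induction with
  | mem v hv =>
    rcases hv with ⟨e, a, he, rfl⟩ | hLt
    · rw [Matrix.mulVec_mulVec, ← pow_succ']
      exact Submodule.subset_span (Or.inl ⟨e, a + 1, he, rfl⟩)
    · exact Submodule.subset_span (Or.inr hLt)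
  | zero => rw [Matrix.mulVec_zero]; exact Submodule.zero_mem _
  | add x y _ _ hx hy => rw [Matrix.mulVec_add]; exact Submodule.add_mem _ hx hy
  | smul a x _ hx => rw [Matrix.mulVec_smul]; exact Submodule.smul_mem _ _ hx

variable {A₀ u w ℓ L}

/-- The rank-one generators LOWER the flag. -/
theorem vecMulVec_mulVec_mem_flagA (hℓ : ∀ e e' (a : ℕ), ℓ e' ≤ ℓ e → w e ⬝ᵥ (A₀ ^ a *ᵥ u e') = 0) (hL : ∀ e, ℓ e < L)
    (e' : κ) (t : ℕ) (x : Fin m → ℂ)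
    (hx : x ∈ Submodule.span ℂ {v : Fin m → ℂ | (∃ e a, ℓ e < t + 1 ∧ v = A₀ ^ a *ᵥ u e) ∨ L < t + 1}) :
    vecMulVec (u e') (w e') *ᵥ x ∈ Submodule.span ℂ {v : Fin m → ℂ | (∃ e a, ℓ e < t ∧ v = A₀ ^ a *ᵥ u e) ∨ L < t} := by
  have hu : ∀ t', ℓ e' < t' → u e' ∈ Submodule.span ℂ {v : Fin m → ℂ | (∃ e a, ℓ e < t' ∧ v = A₀ ^ a *ᵥ u e) ∨ L < t'} :=
    fun t' ht' => Submodule.subset_span (Or.inl ⟨e', 0, ht', by rw [pow_zero, Matrix.one_mulVec]⟩)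
  induction hx using Submodule.span_induction with
  | mem v hv =>
    rw [vecMulVec_mulVec, op_smul_eq_smul]
    rcases hv with ⟨e, a, he, rfl⟩ | hLt
    · by_cases hz : w e' ⬝ᵥ (A₀ ^ a *ᵥ u e) = 0
      · rw [hz, zero_smul]; exact Submodule.zero_mem _
      · have hlt : ℓ e' < ℓ e := by
          by_contra hge
          exact hz (hℓ e' e a (not_lt.mp hge))
        exact Submodule.smul_mem _ _ (hu t (by omega))
    · have := hL e'
      exact Submodule.smul_mem _ _ (hu t (by omega))
  | zero => rw [Matrix.mulVec_zero]; exact Submodule.zero_mem _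
  | add x y _ _ hx hy => rw [Matrix.mulVec_add]; exact Submodule.add_mem _ hx hy
  | smul a x _ hx => rw [Matrix.mulVec_smul]; exact Submodule.smul_mem _ _ hx

/-- The rank-one generators PRESERVE each `F t`. -/
theorem vecMulVec_mulVec_mem_flagA_self (hℓ : ∀ e e' (a : ℕ), ℓ e' ≤ ℓ e → w e ⬝ᵥ (A₀ ^ a *ᵥ u e') = 0) (hL : ∀ e, ℓ e < L)
    (e' : κ) (t : ℕ) (x : Fin m → ℂ)
    (hx : x ∈ Submodule.span ℂ {v : Fin m → ℂ | (∃ e a, ℓ e < t ∧ v = A₀ ^ a *ᵥ u e) ∨ L < t}) :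
    vecMulVec (u e') (w e') *ᵥ x ∈ Submodule.span ℂ {v : Fin m → ℂ | (∃ e a, ℓ e < t ∧ v = A₀ ^ a *ᵥ u e) ∨ L < t} := by
  cases t with
  | zero =>
    rw [eq_zero_of_mem_flagA_zero A₀ u ℓ L hx, Matrix.mulVec_zero]
    exact Submodule.zero_mem _
  | succ t => exact mem_flagA_succ_of_mem A₀ u ℓ L t (vecMulVec_mulVec_mem_flagA hℓ hL e' t x hx)

/-- The family `{A₀} ∪ {u_e w_eᵀ}` (indexed by `Option κ`) PRESERVES each `F t`. -/
theorem family_mulVec_mem_flagA_self (hℓ : ∀ e e' (a : ℕ), ℓ e' ≤ ℓ e → w e ⬝ᵥ (A₀ ^ a *ᵥ u e') = 0) (hL : ∀ e, ℓ e < L)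
    (o : Option κ) (t : ℕ) (x : Fin m → ℂ)
    (hx : x ∈ Submodule.span ℂ {v : Fin m → ℂ | (∃ e a, ℓ e < t ∧ v = A₀ ^ a *ᵥ u e) ∨ L < t}) :
    (o.elim A₀ fun e => vecMulVec (u e) (w e)) *ᵥ x ∈
      Submodule.span ℂ {v : Fin m → ℂ | (∃ e a, ℓ e < t ∧ v = A₀ ^ a *ᵥ u e) ∨ L < t} := by
  cases o with
  | none => exact constPart_mulVec_mem_flagA A₀ u ℓ L t x hx
  | some e => exact vecMulVec_mulVec_mem_flagA_self hℓ hL e t x hx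

/-- Noncommutative polynomials in the family PRESERVE each `F t`. -/
theorem lift_mulVec_mem_flagA (hℓ : ∀ e e' (a : ℕ), ℓ e' ≤ ℓ e → w e ⬝ᵥ (A₀ ^ a *ᵥ u e') = 0) (hL : ∀ e, ℓ e < L)
    (p : FreeAlgebra ℂ (Option κ)) (t : ℕ) (x : Fin m → ℂ)
    (hx : x ∈ Submodule.span ℂ {v : Fin m → ℂ | (∃ e a, ℓ e < t ∧ v = A₀ ^ a *ᵥ u e) ∨ L < t}) :
    (FreeAlgebra.lift ℂ (fun o : Option κ => o.elim A₀ fun e => vecMulVec (u e) (w e)) p) *ᵥ x ∈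
      Submodule.span ℂ {v : Fin m → ℂ | (∃ e a, ℓ e < t ∧ v = A₀ ^ a *ᵥ u e) ∨ L < t} := by
  induction p using FreeAlgebra.induction generalizing x with
  | grade0 r =>
    rw [AlgHom.commutes, Algebra.algebraMap_eq_smul_one, Matrix.smul_mulVec, Matrix.one_mulVec]
    exact Submodule.smul_mem _ _ hx
  | grade1 o => rw [FreeAlgebra.lift_ι_apply]; exact family_mulVec_mem_flagA_self hℓ hL o t x hx
  | mul a b ha hb => rw [map_mul, ← Matrix.mulVec_mulVec]; exact ha _ (hb _ hx)
  | add a b ha hb => rw [map_add, Matrix.add_mulVec]; exact Submodule.add_mem _ (ha _ hx) (hb _ hx)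

/-- A commutator of the family with at least one rank-one member LOWERS the flag. -/
theorem commutator_mulVec_mem_flagA (hℓ : ∀ e e' (a : ℕ), ℓ e' ≤ ℓ e → w e ⬝ᵥ (A₀ ^ a *ᵥ u e') = 0) (hL : ∀ e, ℓ e < L)
    (k l : Option κ) (hkl : ¬ (k = none ∧ l = none)) (t : ℕ) (x : Fin m → ℂ)
    (hx : x ∈ Submodule.span ℂ {v : Fin m → ℂ | (∃ e a, ℓ e < t + 1 ∧ v = A₀ ^ a *ᵥ u e) ∨ L < t + 1}) :
    ((k.elim A₀ fun e => vecMulVec (u e) (w e)) * (l.elim A₀ fun e => vecMulVec (u e) (w e)) -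
      (l.elim A₀ fun e => vecMulVec (u e) (w e)) * (k.elim A₀ fun e => vecMulVec (u e) (w e))) *ᵥ x ∈
      Submodule.span ℂ {v : Fin m → ℂ | (∃ e a, ℓ e < t ∧ v = A₀ ^ a *ᵥ u e) ∨ L < t} := by
  rw [Matrix.sub_mulVec, ← Matrix.mulVec_mulVec, ← Matrix.mulVec_mulVec]
  cases k with
  | some k' =>
    refine Submodule.sub_mem _ ?_ ?_
    · exact vecMulVec_mulVec_mem_flagA hℓ hL k' t _ (family_mulVec_mem_flagA_self hℓ hL l (t + 1) x hx)
    · exact family_mulVec_mem_flagA_self hℓ hL l t _ (vecMulVec_mulVec_mem_flagA hℓ hL k' t x hx)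
  | none =>
    cases l with
    | none => exact absurd ⟨rfl, rfl⟩ hkl
    | some l' =>
      refine Submodule.sub_mem _ ?_ ?_
      · exact constPart_mulVec_mem_flagA A₀ u ℓ L t _ (vecMulVec_mulVec_mem_flagA hℓ hL l' t x hx)
      · exact vecMulVec_mulVec_mem_flagA hℓ hL l' t _ (constPart_mulVec_mem_flagA A₀ u ℓ L (t + 1) x hx)

/-- McCoy's hypothesis for the family `{A₀} ∪ {u_e w_eᵀ}`. -/
theorem isNilpotent_lift_mul_commutatorA (hℓ : ∀ e e' (a : ℕ), ℓ e' ≤ ℓ e → w e ⬝ᵥ (A₀ ^ a *ᵥ u e') = 0) (hL : ∀ e, ℓ e < L)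
    (p : FreeAlgebra ℂ (Option κ)) (k l : Option κ) :
    IsNilpotent (FreeAlgebra.lift ℂ (fun o : Option κ => o.elim A₀ fun e => vecMulVec (u e) (w e)) p *
      ((k.elim A₀ fun e => vecMulVec (u e) (w e)) * (l.elim A₀ fun e => vecMulVec (u e) (w e)) -
        (l.elim A₀ fun e => vecMulVec (u e) (w e)) * (k.elim A₀ fun e => vecMulVec (u e) (w e)))) := by
  by_cases hkl : k = none ∧ l = none
  · obtain ⟨rfl, rfl⟩ := hkl
    rw [sub_self, Matrix.mul_zero]
    exact IsNilpotent.zero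
  set X := FreeAlgebra.lift ℂ (fun o : Option κ => o.elim A₀ fun e => vecMulVec (u e) (w e)) p *
      ((k.elim A₀ fun e => vecMulVec (u e) (w e)) * (l.elim A₀ fun e => vecMulVec (u e) (w e)) -
        (l.elim A₀ fun e => vecMulVec (u e) (w e)) * (k.elim A₀ fun e => vecMulVec (u e) (w e))) with hX
  have hdrop : ∀ t x, x ∈ Submodule.span ℂ {v : Fin m → ℂ | (∃ e a, ℓ e < t + 1 ∧ v = A₀ ^ a *ᵥ u e) ∨ L < t + 1} →
      X *ᵥ x ∈ Submodule.span ℂ {v : Fin m → ℂ | (∃ e a, ℓ e < t ∧ v = A₀ ^ a *ᵥ u e) ∨ L < t} := by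
    intro t x hx
    rw [hX, ← Matrix.mulVec_mulVec]
    exact lift_mulVec_mem_flagA hℓ hL p t _ (commutator_mulVec_mem_flagA hℓ hL k l hkl t x hx)
  have hpow : ∀ j t x, x ∈ Submodule.span ℂ {v : Fin m → ℂ | (∃ e a, ℓ e < t + j ∧ v = A₀ ^ a *ᵥ u e) ∨ L < t + j} →
      (X ^ j) *ᵥ x ∈ Submodule.span ℂ {v : Fin m → ℂ | (∃ e a, ℓ e < t ∧ v = A₀ ^ a *ᵥ u e) ∨ L < t} := by
    intro j
    induction j with
    | zero => intro t x hx; rw [pow_zero, Matrix.one_mulVec]; simpa using hx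
    | succ j ih =>
      intro t x hx
      rw [pow_succ, ← Matrix.mulVec_mulVec]
      exact ih t _ (hdrop (t + j) x (by rw [show t + j + 1 = t + (j + 1) by ring]; exact hx))
  refine ⟨L + 1, ?_⟩
  ext i j
  have hcol : (X ^ (L + 1)) *ᵥ (Pi.single j 1) = 0 := by
    have h := hpow (L + 1) 0 (Pi.single j 1) (by rw [zero_add]; exact mem_flagA_top A₀ u ℓ L _)
    exact eq_zero_of_mem_flagA_zero A₀ u ℓ L h
  have := congrFun hcol i
  rw [Matrix.mulVec_single_one] at this
  exact this

/-- ★ **ONE invertible `S` makes `A₀` AND every `u_e w_eᵀ` upper triangular** (McCoy, ✓ Literature `forall_isNilpotent_iff_exists_isUnit`). -/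
theorem exists_conj_upper_with_constPart (hℓ : ∀ e e' (a : ℕ), ℓ e' ≤ ℓ e → w e ⬝ᵥ (A₀ ^ a *ᵥ u e') = 0) (hL : ∀ e, ℓ e < L) :
    ∃ S : Matrix (Fin m) (Fin m) ℂ, IsUnit S ∧ (∀ a b : Fin m, b < a → (S⁻¹ * A₀ * S) a b = 0) ∧
      ∀ e (a b : Fin m), b < a → (S⁻¹ * vecMulVec (u e) (w e) * S) a b = 0 := by
  obtain ⟨S, hS, h⟩ :=
    (Literature.LinearAlgebra.Matrix.SimultaneousTriangularization.forall_isNilpotent_iff_exists_isUnit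
      (fun o : Option κ => o.elim A₀ fun e => vecMulVec (u e) (w e))).mp (fun p k l => isNilpotent_lift_mul_commutatorA hℓ hL p k l)
  exact ⟨S, hS, fun a b hab => h none hab, fun e a b hab => h (some e) hab⟩

end FlagA

/-! ## §2 ★★★ The row: rank-≤ 1 linear part, arbitrary constant part -/

variable {n : ℕ}

/-- The values of an affine pencil with outer-product coefficients: `N(x) = A₀ + Σ_e x_e • u_e w_eᵀ` with `A₀ i j = coeff 0 (N i j)`. -/
theorem map_eval_eq_constPart_add (N : AffMat n m) (hN : IsAffine N) (u w : Fin n × Fin n → Fin m → ℂ)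
    (hcoef : ∀ e i j, coeff (Finsupp.single e 1) (N i j) = u e i * w e j) (x : Fin n × Fin n → ℂ) :
    N.map (eval x) = (Matrix.of fun i j => coeff 0 (N i j)) + ∑ e, x e • vecMulVec (u e) (w e) := by
  ext i j
  rw [Matrix.map_apply, Matrix.add_apply, Matrix.sum_apply, Matrix.of_apply]
  have haff := Literature.Computability.AlgebraicComplexity.LRPencil.eq_affine_of_totalDegree_le_one (N i j) (hN i j)
  conv_lhs => rw [haff]
  simp only [map_add, map_sum, map_mul, eval_C, eval_X, Matrix.smul_apply, vecMulVec_apply, smul_eq_mul, hcoef]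
  congr 1
  exact Finset.sum_congr rfl fun e _ => by ring

/-- ★★★ **(c) HOLDS WITH `c = 3` FOR EVERY AFFINE NILPOTENT PENCIL WITH RANK-`≤ 1` LINEAR COEFFICIENT MATRICES** (constant part arbitrary):
`N ^ H = 0`, `[x_e] N = u_e w_eᵀ` for all `e` ⇒ `RelCert n m N (3·(⌊√n⌋·m))`. [this file] -/
theorem relCert_of_rankOne_linearPart (N : AffMat n m) (hN : IsAffine N) {H : ℕ} (hnil : N ^ H = 0)
    (u w : Fin n × Fin n → Fin m → ℂ) (hcoef : ∀ e i j, coeff (Finsupp.single e 1) (N i j) = u e i * w e j) :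
    RelCert n m N (3 * (Nat.sqrt n * m)) := by
  classical
  obtain ⟨A₀, hA₀⟩ : ∃ A₀ : Matrix (Fin m) (Fin m) ℂ, A₀ = Matrix.of fun i j => coeff 0 (N i j) := ⟨_, rfl⟩
  have hval := map_eval_eq_constPart_add N hN u w hcoef
  rw [← hA₀] at hval
  have hNm : N ^ m = 0 :=
    Summit.ValiantsHypothesis.ValiantsHypothesis.Theorems.GrenetZeon.SlowCore.pow_card_eq_zero_of_pow_eq_zero N hnil
  have hA0val : N.map (eval 0) = A₀ := by
    rw [hval 0]; simp
  have hA : A₀ ^ m = 0 := by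
    rw [← hA0val, ← Matrix.map_pow, hNm]; exact Matrix.map_zero _ (map_zero _)
  -- homogenised nilpotency of the span `c•A₀ + Σ x_e V_e`
  have hhom : ∀ (c : ℂ) (x : Fin n × Fin n → ℂ), (c • A₀ + ∑ e, x e • vecMulVec (u e) (w e)) ^ (H + m + 1) = 0 := by
    intro c x
    rw [pow_succ]
    by_cases hc : c = 0
    · have hlin : (∑ e, x e • vecMulVec (u e) (w e)) = linPart N x := by
        unfold linPart
        rw [hval x, hA0val, add_sub_cancel_left]
      rw [hc, zero_smul, zero_add, hlin, pow_add, linPart_pow_eq_zero N hN hNm x, Matrix.mul_zero, Matrix.zero_mul]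
    · have hscale : c • A₀ + ∑ e, x e • vecMulVec (u e) (w e) = c • N.map (eval fun e => c⁻¹ * x e) := by
        rw [hval, smul_add, Finset.smul_sum]
        congr 1
        refine Finset.sum_congr rfl fun e _ => ?_
        rw [smul_smul, mul_inv_cancel_left₀ hc]
      rw [hscale, smul_pow, ← Matrix.map_pow, pow_add N H m, hnil, Matrix.zero_mul, Matrix.map_zero _ (map_zero _), smul_zero,
        Matrix.zero_mul]
  obtain ⟨ℓ, hℓ⟩ := exists_levels_resolvent A₀ hA u w hhom
  set L : ℕ := Finset.univ.sup ℓ + 1 with hLdef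
  have hL : ∀ e, ℓ e < L := fun e => Nat.lt_succ_of_le (Finset.le_sup (f := ℓ) (Finset.mem_univ e))
  obtain ⟨S, hS, htri0, htri⟩ := exists_conj_upper_with_constPart hℓ hL
  obtain ⟨uS, huS⟩ := hS
  refine relCert_of_values_triangularisable N hN (Set.range fun x : Fin n × Fin n → ℂ => N.map (eval x))
    (fun x => ⟨x, rfl⟩) uS⁻¹ ?_
  rintro A ⟨x, rfl⟩ i j hji
  have hP : ((uS⁻¹ : (Matrix (Fin m) (Fin m) ℂ)ˣ) : Matrix (Fin m) (Fin m) ℂ) = S⁻¹ := by rw [Matrix.coe_units_inv, huS]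
  have hP' : ((uS⁻¹⁻¹ : (Matrix (Fin m) (Fin m) ℂ)ˣ) : Matrix (Fin m) (Fin m) ℂ) = S := by rw [inv_inv, huS]
  rw [hP, hP']
  have hconj : S⁻¹ * N.map (eval x) * S = S⁻¹ * A₀ * S + ∑ e, x e • (S⁻¹ * vecMulVec (u e) (w e) * S) := by
    rw [hval x, Matrix.mul_add, Matrix.add_mul, Finset.mul_sum, Finset.sum_mul]
    congr 1
    refine Finset.sum_congr rfl fun e _ => ?_
    rw [Matrix.mul_smul, Matrix.smul_mul]
  have hupper : ∀ a b : Fin m, b < a → (S⁻¹ * N.map (eval x) * S) a b = 0 := by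
    intro a b hab
    rw [hconj, Matrix.add_apply, Matrix.sum_apply, htri0 a b hab, zero_add]
    refine Finset.sum_eq_zero fun e _ => ?_
    rw [Matrix.smul_apply, htri e a b hab, smul_zero]
  rcases lt_or_eq_of_le hji with hlt | heq
  · exact hupper i j hlt
  · subst heq
    have hSinv : S⁻¹ * S = 1 := by rw [← huS, ← Matrix.coe_units_inv, ← Units.val_mul, inv_mul_cancel, Units.val_one]
    have hSinv' : S * S⁻¹ = 1 := by rw [← huS, ← Matrix.coe_units_inv, ← Units.val_mul, mul_inv_cancel, Units.val_one]
    have hnilx : IsNilpotent (S⁻¹ * N.map (eval x) * S) := by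
      refine ⟨H, ?_⟩
      have h1 := conj_pow_eq S⁻¹ S (N.map (eval x)) hSinv' H
      rw [← Matrix.map_pow, hnil, Matrix.map_zero _ (map_zero _)] at h1
      have h3 : (S⁻¹ * N.map (eval x) * S) ^ H = (S⁻¹ * S) * (S⁻¹ * N.map (eval x) * S) ^ H * (S⁻¹ * S) := by
        rw [hSinv, Matrix.one_mul, Matrix.mul_one]
      rw [h3, show (S⁻¹ * S) * (S⁻¹ * N.map (eval x) * S) ^ H * (S⁻¹ * S) =
        S⁻¹ * (S * (S⁻¹ * N.map (eval x) * S) ^ H * S⁻¹) * S by simp only [Matrix.mul_assoc], h1,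
        Matrix.mul_zero, Matrix.zero_mul]
    refine diag_eq_zero_of_isNilpotent_triangular (fun a : Fin m => m - (a : ℕ)) (fun a b hab => Fin.ext (by
      have := a.is_lt; have := b.is_lt; beta_reduce at hab; omega)) _ (fun a b hab => hupper a b ?_) hnilx j
    have := a.is_lt; have := b.is_lt
    beta_reduce at hab
    exact Fin.lt_def.mpr (by omega)

/-- ★★★ In the binder shape of (c) / `LongMassSlowLawAll`: every affine nilpotent `b × b` pencil over the `n²` coordinates whose coefficient matrices
all have rank `≤ 1` (outer products) has price `≤ 3·(√n·b)`. [this file] -/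
theorem longMass_on_rankOne_linearPart_locus :
    ∀ (n b : ℕ) (B : AffMat n b), IsAffine B → B ^ b = 0 →
      (∃ u w : Fin n × Fin n → Fin b → ℂ, ∀ e i j, coeff (Finsupp.single e 1) (B i j) = u e i * w e j) →
      RelCert n b B (3 * (Nat.sqrt n * b)) := by
  intro n b B hB hnil ⟨u, w, hcoef⟩
  exact relCert_of_rankOne_linearPart B hB hnil u w hcoef

end Summit.ValiantsHypothesis.ValiantsHypothesis.Theorems.GrenetZeon.LongMassRankOne

end
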